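import Literature.MathematicalPhysics.QuantumFieldTheory.Balaban1983to89.Node00.Record13CarriersCo
import Literature.MathematicalPhysics.QuantumFieldTheory.Balaban1983to89.B8LeafModelZd3SourceReality

/-!
# BalabanUVNodes ∕ N05 — LOCATED NEGATIVE: the K1 engine's X-PINNED presentation `Stage13Params.pinX3 θ lam8 lam12 lam13` (`Node00/Record13CarriersXPinned`,
# `XPinned₁₃ := ((X.withB8OfRecordSubB θ₃ lam8).withB12 …).withB13OfRecord …`) pins the [B8] group on the UN-REPAIRED carrier `famB8OfRecordSubB` (n05-a's
# `zdGF3`), whose leaf is certified EMPTY (`B8LeafModelZd3SourceReality.not_b8LeafOfRecordSubB`, p501857) ⇒ at EVERY world bound by the C-binding over an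
# X-pinned Stage-13 view (U_old `toStage5₁₃` OR print's-background `toStage5₁₃Co` — the fact is background-FREE) the `b8` leaf is FALSE at every run, for
# EVERY `lam8`; hence N05's main `Dag.B8_main` holds there only ex falso (`¬ b5 ∨ ¬ b6 ∨ ¬ b7 ∨ ¬ b9`) — the engine's N05 socket `socket05_pinX3_iff` is unservable

Track A of `YM-PLAN.md` (cell `pub-ymgap`, HUMAN RULING D-0062), node **N05**; seat `pub-ymgap-dag-n05-d` (g6), 2026-08-27.  KERNEL CERTIFICATE by name, no new
mathematics: `(upOfRecord₅C F N (σ.rebindX F N (XPinned₁₃ F N θ lam8 lam12 lam13)) P).b8` IS (definitionally, `Record13CarriersXPinned.socket05_pinX3_iff`'s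
right-hand side) the TYPED [B8″] leaf `B8LeafR … (famB8OfRecordSubB θ₃ lam8.β lam8.len ·) lam8.lan lam8.cub lam8.toAxial`, which implies the surviving slot
`B8LeafOfRecordSubB θ₃ lam8` (`CarriersB8SubB.b8LeafOfRecordSubB_of_b8LeafR`, typed ⇒ surviving under (1.36) ⊂ (1.62)), which is FALSE for `θ₃.D ≥ 2`
(`not_b8LeafOfRecordSubB`: the carrier's source space admits non-Hermitian sources, for which Theorem 8's sentence fails).
REPAIR (one token, the X-pin owner's — dag-n10-d `Record13CarriersXPinned` ∕ its CoP image; dag-n24-c's engine modules read it): `withB8OfRecordSubB ↦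
withB8OfRecordSubBH` in `XPinned₁₃` (the REPAIRED carrier pin `Node00/CarriersB8SubBH`, dag-n05-c g6), i.e. an `XPinned₁₃H ∕ pinX3H`; then the engine's N05 socket is
the typed leaf over `famB8OfRecordSubBH`, whose SURVIVING form this seat's knits serve (`BalabanUVNodesN05SubBHKnitUniv(T8Srv)`) — the S-bound ₁₃ faces
(`IsRecordOfRecord₁₃CSepCo(P)SB8subBH`) are the ∃-currency supply.
WHAT IS PROVED: `not_b8_upOfRecord₅C_rebindX_xPinned₁₃` (ANY Stage-5 view `σ`), its two instances `not_b8_upOfRecord₅C_toStage5₁₃_pinX3` (U_old) ∕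
`not_b8_upOfRecord₅C_toStage5₁₃Co_pinX3` (print's background, FILE 21 ∕ dag-n10-d's `toStage5₁₃Co_pinX3`), and the node reading `false_of_b8_main_at_xPinned₁₃`
(`Dag.B8_main` + the leaves `b5 b6 b7 b9` at such a world ⇒ `False`: the engine cannot hold N02–N04, N06 and N05 together at an X-pinned world as typed); and the
same for the S-bound five-pin Co VIEWS `view₁₃CoB8B10YZW` ∕ `view₁₃CoB8subB10YZW` of `Record13CarriersCo` §5 (`not_b8_upOfRecord₅CS_view₁₃CoB8(sub)B10YZW`: their [B8] ∕
[B8′] pins are the un-repaired `pinB8` ∕ `pinB8Sub`, leaves `B8LeafOfRecord(Sub)` refuted by `not_b8LeafOfRecord(Sub)`) — in the whole carrier stack ONLY the [B8″H]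
pin (`pinB8SubBH`, `Node00/(Record13)CarriersB8SubBH(Co)`) has a `b8` leaf without a kernel refutation.
HONEST FRAMING: a located NEGATIVE typing certificate about the tree's own pin (count-neutral); nothing of [Balaban1985RegularSpaces] proved or refuted (print is consistent:
Theorem 8's `f` is Lie-algebra valued); N05 NOT discharged; K1 NOT claimed; SECOND-GAP: none; one finite 𝕋⁴ programme at fixed ε; nothing continuum ∕ ℝ⁴ ∕ OS ∕ mass-gap ∕
Clay.  No `sorry`, no new definition.
[cite: Balaban1985RegularSpaces, Thm 8 (1.146) p.101 («f … 𝔤-valued»), Lemma 1 – Thm 8 pp.79–101 (the typed leaf), (1.36) p.82, (1.62) p.87; Balaban1989LargeFieldII, Thm 1 + (0.1) pp.355–356 (the record's pins, bookkeeping)]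
-/

noncomputable section

namespace Summit.QuantumFields.YangMills.BalabanUVNodes.N05XPinVacuity

open Literature.MathematicalPhysics.QuantumFieldTheory.Balaban1983to89
open Literature.MathematicalPhysics.QuantumFieldTheory.Balaban1983to89.Node00
open Literature.MathematicalPhysics.QuantumFieldTheory.Balaban1983to89.T4Continuum
open Literature.MathematicalPhysics.QuantumFieldTheory.Balaban1983to89.DagBinding
open Literature.MathematicalPhysics.QuantumFieldTheory.Balaban1983to89.B8LeafModelZd3SourceReality
  (not_b8LeafOfRecordSubB not_b8LeafOfRecord not_b8LeafOfRecordSub)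

variable {F : T4Family} {N : ℕ} [NeZero N]

/-- ★ **AT ANY STAGE-5 VIEW RE-BOUND TO THE X-PINNED CARRIERS, THE C-BINDING's `b8` LEAF IS FALSE** (every run `P`, every [B8] layer `lam8`; `θ₃.D ≥ 2`): the leaf is the
typed [B8″] leaf over the un-repaired `famB8OfRecordSubB` (`socket05_pinX3_iff`'s reading, definitional), typed ⇒ surviving (`b8LeafOfRecordSubB_of_b8LeafR`), surviving
refuted (`not_b8LeafOfRecordSubB`). [cite: Balaban1985RegularSpaces, Thm 8 (1.146) p.101, (1.36) p.82, (1.62) p.87] -/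
theorem not_b8_upOfRecord₅C_rebindX_xPinned₁₃ (σ : Stage5Params F N) (θ : Stage13Params F N) (hD : 2 ≤ θ.toStage3Params.D)
    (lam8 : ResidB8 θ.toStage3Params) (lam12 : ResidB12 F N θ.τ9.M) (lam13 : B12.RunParams → ResidB13 θ.toStage3Params) (P : B12.RunParams) :
    ¬ (upOfRecord₅C F N (σ.rebindX F N (XPinned₁₃ F N θ lam8 lam12 lam13)) P).b8 := fun h =>
  not_b8LeafOfRecordSubB θ.toStage3Params hD lam8 (b8LeafOfRecordSubB_of_b8LeafR (θ := θ.toStage3Params) lam8 h)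

/-- The U_old instance: at the X-pinned Stage-13 view of record `((θ.pinX3 lam8 lam12 lam13).toStage5₁₃`, `Record13CarriersXPinned.toStage5₁₃_pinX3`) the `b8` leaf is FALSE.
[cite: Balaban1985RegularSpaces, Thm 8 (1.146) p.101; Balaban1989LargeFieldII, Thm 1 p.355 (bookkeeping)] -/
theorem not_b8_upOfRecord₅C_toStage5₁₃_pinX3 (θ : Stage13Params F N) (hD : 2 ≤ θ.toStage3Params.D)
    (lam8 : ResidB8 θ.toStage3Params) (lam12 : ResidB12 F N θ.τ9.M) (lam13 : B12.RunParams → ResidB13 θ.toStage3Params) (P : B12.RunParams) :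
    ¬ (upOfRecord₅C F N ((θ.pinX3 F N lam8 lam12 lam13).toStage5₁₃ F N) P).b8 := by
  rw [Stage13Params.toStage5₁₃_pinX3]
  exact not_b8_upOfRecord₅C_rebindX_xPinned₁₃ _ θ hD lam8 lam12 lam13 P

/-- The print's-background instance (director-ym №152 (β); FILE 21 ∕ dag-n10-d's `Record13CarriersCo.toStage5₁₃Co_pinX3`): at `((θ.pinX3 lam8 lam12 lam13).toStage5₁₃Co` the `b8`
leaf is FALSE — the fact is background-free, so every later edition (`CoP`) inherits it verbatim. [cite: Balaban1985RegularSpaces, Thm 8 (1.146) p.101; Balaban1988Convergent, (2.12)–(2.13) pp.256–257 (bookkeeping)] -/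
theorem not_b8_upOfRecord₅C_toStage5₁₃Co_pinX3 (θ : Stage13Params F N) (hD : 2 ≤ θ.toStage3Params.D)
    (lam8 : ResidB8 θ.toStage3Params) (lam12 : ResidB12 F N θ.τ9.M) (lam13 : B12.RunParams → ResidB13 θ.toStage3Params) (P : B12.RunParams) :
    ¬ (upOfRecord₅C F N ((θ.pinX3 F N lam8 lam12 lam13).toStage5₁₃Co F N) P).b8 := by
  rw [Stage13Params.toStage5₁₃Co_pinX3]
  exact not_b8_upOfRecord₅C_rebindX_xPinned₁₃ _ θ hD lam8 lam12 lam13 P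

/-- ★ **THE NODE READING**: at a world bound by the C-binding over ANY Stage-5 view re-bound to the X-pinned carriers, N05's main `Dag.B8_main` together with the
leaves `b5 b6 b7` (N02 ∕ N03 ∕ N04) and `b9` (N06) is CONTRADICTORY — so the K1 engine cannot hold all node mains at an X-pinned world as typed (its N05 socket is
unservable; repair = pin the [B8] group on the repaired carrier `withB8OfRecordSubBH`). [cite: Balaban1985RegularSpaces, Thm 2 p.83, Thm 8 (1.146) p.101; Balaban1989LargeFieldII, Thm 1 p.355 (bookkeeping)] -/
theorem false_of_b8_main_at_xPinned₁₃ (σ : Stage5Params F N) (θ : Stage13Params F N) (hD : 2 ≤ θ.toStage3Params.D)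
    (lam8 : ResidB8 θ.toStage3Params) (lam12 : ResidB12 F N θ.τ9.M) (lam13 : B12.RunParams → ResidB13 θ.toStage3Params)
    {w : WorldP} (hup : ∀ P, w.up P = upOfRecord₅C F N (σ.rebindX F N (XPinned₁₃ F N θ lam8 lam12 lam13)) P) (P : B12.RunParams)
    (hN : Dag.B8_main (leavesP w P)) (h5 : (leavesP w P).b5) (h6 : (leavesP w P).b6) (h7 : (leavesP w P).b7) (h9 : (leavesP w P).b9) : False := by
  have h8 : (w.up P).b8 := hN h5 h6 h7 h9
  rw [hup P] at h8
  exact not_b8_upOfRecord₅C_rebindX_xPinned₁₃ σ θ hD lam8 lam12 lam13 P h8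

/-! ## The five-pin Co VIEWS of the carrier stack (`Record13CarriersCo` §5) carry the same defect: their [B8] ∕ [B8′] pins are the un-repaired
`pinB8` ∕ `pinB8Sub`, so the S-binding's `b8` leaf over them is FALSE too (every `lam`, every run) -/

/-- At the S-bound five-pin Co view `θ.view₁₃CoB8B10YZW lam …` the `b8` leaf (= `B8LeafOfRecord θ₃ lam`, `upOfRecord₅CS_view₁₃CoB8B10YZW_leaves`) is FALSE
(`not_b8LeafOfRecord`). [cite: Balaban1985RegularSpaces, Thm 8 (1.146) p.101; Balaban1988Convergent, p.244 (bookkeeping)] -/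
theorem not_b8_upOfRecord₅CS_view₁₃CoB8B10YZW (θ : Stage13Params F N) (hD : 2 ≤ θ.toStage3Params.D) (lam : ResidB8 θ.toStage3Params) (Mstar : ℕ)
    (ops : OpsY N θ.toStage3Params Mstar) (ζ : ResidZ F N) (lamW : ResidW F N) (P : B12.RunParams) :
    ¬ (upOfRecord₅CS F N (θ.view₁₃CoB8B10YZW F N lam Mstar ops ζ lamW) P).b8 := fun h =>
  not_b8LeafOfRecord θ.toStage3Params hD lam ((upOfRecord₅CS_view₁₃CoB8B10YZW_leaves F N θ lam Mstar ops ζ lamW P).1.1 h)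

/-- At the S-bound five-pin Co view `θ.view₁₃CoB8subB10YZW lam …` the `b8` leaf (= `B8LeafOfRecordSub θ₃ lam`) is FALSE (`not_b8LeafOfRecordSub`).
[cite: Balaban1985RegularSpaces, Thm 8 (1.146) p.101; Balaban1988Convergent, p.244 (bookkeeping)] -/
theorem not_b8_upOfRecord₅CS_view₁₃CoB8subB10YZW (θ : Stage13Params F N) (hD : 2 ≤ θ.toStage3Params.D) (lam : ResidB8 θ.toStage3Params) (Mstar : ℕ)
    (ops : OpsY N θ.toStage3Params Mstar) (ζ : ResidZ F N) (lamW : ResidW F N) (P : B12.RunParams) :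
    ¬ (upOfRecord₅CS F N (θ.view₁₃CoB8subB10YZW F N lam Mstar ops ζ lamW) P).b8 := fun h =>
  not_b8LeafOfRecordSub θ.toStage3Params hD lam ((upOfRecord₅CS_view₁₃CoB8subB10YZW_leaves F N θ lam Mstar ops ζ lamW P).1.1 h)

#print axioms not_b8_upOfRecord₅C_rebindX_xPinned₁₃
#print axioms false_of_b8_main_at_xPinned₁₃

end Summit.QuantumFields.YangMills.BalabanUVNodes.N05XPinVacuity

end
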